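import Literature.NumberTheory.EllipticCurves.BSDConductorProofs
import Literature.NumberTheory.EllipticCurves.HasseWeilAbelianConductor
import Literature.NumberTheory.EllipticCurves.HasseWeilAbelianConductorProofs
import HarnessLib

/-!
# bsd.S15 (d), ideal form `𝔣(E/ℚ) = 𝔣^{(ℓ)}(V_ℓ E) · (ℓ)^{f_ℓ}`: reduction to the deep inputs

Sibling proof file of `Literature.NumberTheory.EllipticCurves.BSDConductor` for its named fact
`Literature.BSD.conductor_eq_conductorOf_mul W ℓ` — *for an elliptic curve `E/ℚ` and every prime `ℓ`,
the conductor ideal `𝔣(E/ℚ) = ∏_v v^{f_v}` of `𝓞 ℚ` (item G22, `f_v` defined by Ogg's formula)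
is the prime-to-`ℓ` Artin conductor `𝔣^{(ℓ)}(V_ℓ E) = ∏_{v ∤ ℓ} v^{a_v(V_ℓ E)}` of the
`ℓ`-adic representation (item C15 `Literature.NumberTheory.EllipticCurves.conductorOf`) times `v_ℓ^{f_ℓ}`* (Silverman, *ATAEC*,
§IV.10, Definition of the conductor, PDF p. 364, with Thm. 10.2 and Ogg's formula IV.11.1;
Serre–Tate 1968, §2.1 and Thm. 3).

`BSDConductorProofs` proves the assembly
`Literature.NumberTheory.EllipticCurves.conductor_eq_conductorOf_mul_of_artinConductorExponent`: the fact follows, for elliptic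
`W`, from the exponentwise C15 schema `WeierstrassCurve.artinConductorExponent_tate_eq_conductorExponent W ℓ`
(`a_v(V_ℓ E) = f_v(E)` for all `v ∤ ℓ`).  This file records the three sharper reductions that the
tree now affords, so that the discharge `conductor_eq_conductorOf_mul_holds` becomes mechanical
once the remaining leaves land:

* `conductor_eq_conductorOf_mul_of_isElliptic_of_tate` — from the *corrected* (elliptic-only)
  C15 fact `WeierstrassCurve.artinConductorExponent_tate_eq_conductorExponent_of_isElliptic W ℓ`
  of `HasseWeilAbelian` (the uncorrected schema is false for some singular `W` and will never be
  discharged; for an elliptic `W` the two agree);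
* `conductor_eq_conductorOf_mul_of_tame_of_wild` — from the tame and wild parts
  `WeierstrassCurve.codimFixed_inertia_rationalTate_eq_tameConductorExponent W ℓ` (Silverman
  *ATAEC* Thm. IV.10.2(a)) and `WeierstrassCurve.swanConductorAt_rationalTate_eq_wildConductorExponent W ℓ`
  (Ogg's formula IV.11.1) of `HasseWeilAbelianConductor`, through its assembly
  `artinConductorExponent_tate_eq_conductorExponent_of_isElliptic_of_tame_of_wild`;
* `conductor_eq_conductorOf_mul_of_bad` — from the C15 identity at the finitely many *bad* primes
  `p ≠ ℓ` of `E` alone, the primes of good reduction being settled by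
  `WeierstrassCurve.artinConductorExponent_tate_eq_conductorExponent_of_hasGoodReductionAt`
  (`HasseWeilAbelianConductorProofs`: Silverman *AEC* VII.4.1(b), *ATAEC* IV.10.2 good case).

* `conductor_eq_conductorOf_mul_of_facts` / `…_of_facts'` / `…_of_isSemistable` — from the four
  bad-place named facts of `HasseWeilAbelianConductor` (Thm. IV.10.2(a) multiplicative/additive,
  IV.10.2(b) multiplicative, IV.11.1 additive; resp. with the additive wild part split by residue
  characteristic; resp. semistable `W` from the two multiplicative-place facts), through the
  assemblies `artinConductorExponent_tate_eq_conductorExponent_of_isElliptic_of_facts{,'}` and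
  `…_of_isElliptic_of_isSemistable` of `HasseWeilAbelianConductorProofs`.  The discharge
  `conductor_eq_conductorOf_mul_holds` is `…_of_facts` fed with the four `_holds`.

Theorems only; `namespace Literature.BSD`, `W : WeierstrassCurve ℚ`, `[W.IsElliptic]` a theorem-level
instance argument (the parent `def` does not carry it, see `BSDConductorProofs`).

## References

* J. H. Silverman, *Advanced Topics in the Arithmetic of Elliptic Curves*, GTM 151 (1994), §IV.10
  (Definition of `ε, δ, f`, Thm. 10.2, PDF p. 358; Definition of `𝔣(E/K)`, PDF p. 364), §IV.11
  (Ogg's formula 11.1, PDF p. 365). [SilvermanATAEC1994]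
* J.-P. Serre, J. Tate, *Good reduction of abelian varieties*, Ann. of Math. 88 (1968), §2.1,
  §3. [SerreTate1968]
-/

noncomputable section

open scoped Classical NumberField
open IsDedekindDomain WeierstrassCurve Field

namespace Literature.NumberTheory.EllipticCurves

variable (W : WeierstrassCurve ℚ) (ℓ : ℕ) [Fact ℓ.Prime]

/-- **bsd.S15 (d), ideal form, from the corrected C15 fact.**  For an elliptic `W / ℚ`,
`Literature.BSD.conductor_eq_conductorOf_mul W ℓ` (`𝔣(E/ℚ) = 𝔣^{(ℓ)}(V_ℓ E) · v_ℓ^{f_ℓ}`) follows from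
Ogg–Saito in Galois form for elliptic curves,
`WeierstrassCurve.artinConductorExponent_tate_eq_conductorExponent_of_isElliptic W ℓ`
(`a_v(V_ℓ E) = f_v(E)` for `v ∤ ℓ`; Silverman *ATAEC* IV.10.2 with IV.11.1, Serre–Tate 1968
§2.1), via `conductor_eq_conductorOf_mul_of_artinConductorExponent`.
[cite: SilvermanATAEC1994, §IV.10 Definition of the conductor (PDF p. 364) with Thm. IV.11.1] -/
theorem conductor_eq_conductorOf_mul_of_isElliptic_of_tate [W.IsElliptic]
    (hA : W.artinConductorExponent_tate_eq_conductorExponent_of_isElliptic ℓ) :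
    conductor_eq_conductorOf_mul W ℓ :=
  conductor_eq_conductorOf_mul_of_artinConductorExponent W ℓ fun h v hv ↦ hA h v hv

/-- **bsd.S15 (d), ideal form, from the tame and wild parts of the conductor.**  For an elliptic
`W / ℚ`, `Literature.BSD.conductor_eq_conductorOf_mul W ℓ` follows from Silverman *ATAEC*
Thm. IV.10.2(a) in Galois form (`codim (V_ℓ E)^{I_𝔓} = ε_v`,
`WeierstrassCurve.codimFixed_inertia_rationalTate_eq_tameConductorExponent W ℓ`) and Ogg's formula
IV.11.1 in Swan form (`Sw_𝔓(V_ℓ E) = δ_v`,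
`WeierstrassCurve.swanConductorAt_rationalTate_eq_wildConductorExponent W ℓ`), through the assembly
`artinConductorExponent_tate_eq_conductorExponent_of_isElliptic_of_tame_of_wild` of
`HasseWeilAbelianConductor` (`a_v = ⌊ε_v + δ_v⌋₊ = f_v`).
[cite: SilvermanATAEC1994, §IV.10 Definition and Thm. IV.10.2(a), Thm. IV.11.1 (PDF pp. 358, 364–365)] -/
theorem conductor_eq_conductorOf_mul_of_tame_of_wild [W.IsElliptic]
    (hT : W.codimFixed_inertia_rationalTate_eq_tameConductorExponent ℓ)
    (hW : W.swanConductorAt_rationalTate_eq_wildConductorExponent ℓ) :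
    conductor_eq_conductorOf_mul W ℓ :=
  conductor_eq_conductorOf_mul_of_isElliptic_of_tate W ℓ
    (W.artinConductorExponent_tate_eq_conductorExponent_of_isElliptic_of_tame_of_wild ℓ hT hW)

/-- **bsd.S15 (d), ideal form, from Ogg–Saito at the bad primes only.**  For an elliptic `W / ℚ`
and a prime `ℓ`, `Literature.BSD.conductor_eq_conductorOf_mul W ℓ` follows from the identity
`a_v(V_ℓ E) = f_v(E)` at the finitely many places `v ∤ ℓ` of *bad* reduction of `E`
(`v ∈ W.badPlaces (𝓞 ℚ)`, hypothesis `hbad`; Silverman *ATAEC* Thm. IV.10.2 with Ogg's formula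
IV.11.1 at the multiplicative and additive primes): at the places of good reduction both
exponents vanish, `WeierstrassCurve.artinConductorExponent_tate_eq_conductorExponent_of_hasGoodReductionAt`
(`HasseWeilAbelianConductorProofs`, from Silverman *AEC* VII.4.1(b)).
[cite: SilvermanATAEC1994, Thm. IV.10.2 and Thm. IV.11.1 (PDF pp. 358, 365), with §IV.10 Definition of the conductor (PDF p. 364)] -/
theorem conductor_eq_conductorOf_mul_of_bad [W.IsElliptic]
    (hbad : ∀ (h : Continuous fun x : absoluteGaloisGroup ℚ × RationalTateModule (geomPoints W) ℓ ↦
        rationalTateRepresentation (absoluteGaloisGroup ℚ) (geomPoints W) ℓ x.1 x.2)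
      (v : HeightOneSpectrum (𝓞 ℚ)), (ℓ : 𝓞 ℚ) ∉ v.asIdeal → v ∈ W.badPlaces (𝓞 ℚ) →
        conductorExponentOf (geomPoints W) ℓ h v = W.conductorExponent v) :
    conductor_eq_conductorOf_mul W ℓ := by
  refine conductor_eq_conductorOf_mul_of_artinConductorExponent W ℓ fun h v hv ↦ ?_
  by_cases hgood : W.HasGoodReductionAt v
  · exact W.artinConductorExponent_tate_eq_conductorExponent_of_hasGoodReductionAt ℓ h hgood hv
  · exact hbad h v hv hgood

/-! ### From the four bad-place facts (the leaves of the decomposition) -/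

/-- **bsd.S15 (d), ideal form, from the four bad-place facts.**  For an elliptic `W / ℚ` and a
prime `ℓ`, `Literature.BSD.conductor_eq_conductorOf_mul W ℓ` (`𝔣(E/ℚ) = 𝔣^{(ℓ)}(V_ℓ E) · v_ℓ^{f_ℓ}`)
follows from Silverman *ATAEC* Thm. IV.10.2(a) at the multiplicative and additive places
(`codim (V_ℓ E)^{I_𝔓} = 1`, resp. `= 2`: the named facts
`codimFixed_inertia_rationalTate_eq_one_of_hasMultiplicativeReductionAt`,
`codimFixed_inertia_rationalTate_eq_two_of_hasAdditiveReductionAt`), Thm. IV.10.2(b) at the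
multiplicative places (`Sw_𝔓(V_ℓ E) = 0`,
`swanConductorAt_rationalTate_eq_zero_of_hasMultiplicativeReductionAt`) and Ogg's formula IV.11.1
at the additive places (`Sw_𝔓(V_ℓ E) = δ_v`,
`swanConductorAt_rationalTate_eq_wildConductorExponent_of_hasAdditiveReductionAt`), all of
`HasseWeilAbelianConductor`; the places of good reduction, the bookkeeping
`a_v = ⌊ε_v + δ_v⌋₊ = f_v` (`artinConductorExponent_tate_eq_conductorExponent_of_isElliptic_of_facts`,
`HasseWeilAbelianConductorProofs`) and the passage to ideals
(`conductor_eq_conductorOf_mul_of_isElliptic_of_tate`) being theorems.  The discharge `conductor_eq_conductorOf_mul_holds` is this theorem fed with the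
four `_holds`.
[cite: SilvermanATAEC1994, Thm. IV.10.2 and Thm. IV.11.1 (PDF pp. 358–366), with §IV.10 Definition (p. 364)] -/
theorem conductor_eq_conductorOf_mul_of_facts [W.IsElliptic]
    (hTm : W.codimFixed_inertia_rationalTate_eq_one_of_hasMultiplicativeReductionAt ℓ)
    (hTa : W.codimFixed_inertia_rationalTate_eq_two_of_hasAdditiveReductionAt ℓ)
    (hWm : W.swanConductorAt_rationalTate_eq_zero_of_hasMultiplicativeReductionAt ℓ)
    (hWa : W.swanConductorAt_rationalTate_eq_wildConductorExponent_of_hasAdditiveReductionAt ℓ) :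
    conductor_eq_conductorOf_mul W ℓ :=
  conductor_eq_conductorOf_mul_of_isElliptic_of_tate W ℓ
    (W.artinConductorExponent_tate_eq_conductorExponent_of_isElliptic_of_facts ℓ hTm hTa hWm hWa)

/-- **bsd.S15 (d), ideal form, with Ogg's formula split by residue characteristic.**  As
`conductor_eq_conductorOf_mul_of_facts`, with the additive wild part supplied as Thm. IV.10.2(b),
clause `p ≥ 5` (`swanConductorAt_rationalTate_eq_zero_of_ringChar_ne`: `Sw = 0` at the places of
residue characteristic `≠ 2, 3`) and Ogg–Saito at the additive places of residue characteristic
`2, 3` (`swanConductorAt_rationalTate_eq_wildConductorExponent_of_ringChar_eq`), through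
`artinConductorExponent_tate_eq_conductorExponent_of_isElliptic_of_facts'`.
[cite: SilvermanATAEC1994, Thm. IV.10.2 and Thm. IV.11.1 (PDF pp. 358–370)] -/
theorem conductor_eq_conductorOf_mul_of_facts' [W.IsElliptic]
    (hTm : W.codimFixed_inertia_rationalTate_eq_one_of_hasMultiplicativeReductionAt ℓ)
    (hTa : W.codimFixed_inertia_rationalTate_eq_two_of_hasAdditiveReductionAt ℓ)
    (hWm : W.swanConductorAt_rationalTate_eq_zero_of_hasMultiplicativeReductionAt ℓ)
    (hW5 : W.swanConductorAt_rationalTate_eq_zero_of_ringChar_ne ℓ)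
    (hW23 : W.swanConductorAt_rationalTate_eq_wildConductorExponent_of_ringChar_eq ℓ) :
    conductor_eq_conductorOf_mul W ℓ :=
  conductor_eq_conductorOf_mul_of_isElliptic_of_tate W ℓ
    (W.artinConductorExponent_tate_eq_conductorExponent_of_isElliptic_of_facts' ℓ hTm hTa hWm hW5
      hW23)

/-- **bsd.S15 (d), ideal form, for semistable curves.**  For a semistable elliptic `W / ℚ`
(good or multiplicative reduction at every place, `W.IsSemistable (𝓞 ℚ)`) and a prime `ℓ`,
`Literature.BSD.conductor_eq_conductorOf_mul W ℓ` follows from the two multiplicative-place facts alone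
(Silverman *ATAEC* Thm. IV.10.2(a),(b) via the Tate curve; Example 10.5: `𝔣(E/K) = ∏_{𝔭 ∣ 𝒟} 𝔭`
for semistable `E`), through
`artinConductorExponent_tate_eq_conductorExponent_of_isElliptic_of_isSemistable`.
[cite: SilvermanATAEC1994, Thm. IV.10.2 and Example 10.5 (PDF pp. 358–364)] -/
theorem conductor_eq_conductorOf_mul_of_isSemistable [W.IsElliptic] (hs : W.IsSemistable (𝓞 ℚ))
    (hTm : W.codimFixed_inertia_rationalTate_eq_one_of_hasMultiplicativeReductionAt ℓ)
    (hWm : W.swanConductorAt_rationalTate_eq_zero_of_hasMultiplicativeReductionAt ℓ) :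
    conductor_eq_conductorOf_mul W ℓ :=
  conductor_eq_conductorOf_mul_of_isElliptic_of_tate W ℓ
    (W.artinConductorExponent_tate_eq_conductorExponent_of_isElliptic_of_isSemistable ℓ hs hTm hWm)

end Literature.NumberTheory.EllipticCurves

end
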